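import Literature.MathematicalPhysics.QuantumFieldTheory.Balaban1983to89.B9Thm34HolderInputG

/-!
# `Balaban1983to89.B9Thm34HolderInputGp` — [Balaban1985BackgroundPropagators] THEOREM 3.4 p. 400 × THEOREM 3.1 p. 397: THE INPUT-HÖLDER MEMBERS
# (3.44)/(3.45) p. 398 («|(∇_UG′(U)∇*_Uλ)(x)| ≦ B′₀(ε)(…)e^{−δ₀d(y,y′)}» and its Hölder-output twin, the right-hand sides carrying the Hölder norm
# OF THE INPUT `λ`) FOR THE CONCRETE EXTENDED `G′(U′U) = G′(U)(I − V′(A)G′(U))⁻¹` OF (3.64) — FILE 38 of the Sect. B programme of cell `lit-balaban`,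
# seat r06 gen 18; the `G′`-side companion of FILE 37 (same devices, the concrete `V′(A)` of (3.60) in gradient form)

statement-level skeleton of published theorems with citation tags; proofs where landed; nothing here is a claim about the Yang–Mills mass gap

CITATION HEADER (lean-in-tree rule).  B9 = T. Bałaban, *Propagators for lattice gauge theories in a background field*, Commun. Math. Phys. **99** (1985)
389–434 [Balaban1985BackgroundPropagators] (doi 10.1007/bf01240355; `paper:balaban1985-cmp99-background-propagators`, journal page = PDF page + 388):
Theorem 3.1 (3.42)–(3.45) pp. 397–398 [PDF 9–10] — after (3.43): «Furthermore, there exist constants B′₀(ε), B′₀(ε, β) dependent on d, L and the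
indicated parameters, 0 < ε ≦ 1, 0 ≦ β < 1 (B′₀(ε) → ∞ if ε → 0, B′₀(ε,β) → ∞ if either ε → 0, or β → 1), such that» (3.44) (the sup of
`|(∇_UG′(U)∇*_Uλ)(x)|`, `x ∈ Δ(y)`, `supp λ ⊂ Δ̃(y′)`, bounded by `B′₀(ε)` times an `ε`-Hölder norm of `λ` at the scale `ξ′ = L^{−j′}` plus `|λ|`, times
`e^{−δ₀d(y,y′)}`) and (3.45) (its `β`-Hölder-output twin with `B′₀(ε,β)`); Theorem 3.4 p. 400 [PDF 12] («The extended operators satisfy all the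
inequalities of Theorems 3.1–3.3 correspondingly»); (3.60)–(3.65) p. 402 [PDF 14] (`V′(A)` «defined by the last equality» of (3.60); «It satisfies the bound |(V′(A)λ)(x)| ≦ O(1)α₁((Lʲη)⁻¹|∇_Uλ| +
(Lʲη)⁻²|λ|) (3.61) for x ∈ Bʲ(Λ_j), the norms on the right-hand side restricted to the block Bʲ(y) containing the point x»; «G′(U′U) = G′(U)(I −
V′(A)G′(U))⁻¹ = Σ_{n=0}^∞ G′(U)(V′(A)G′(U))ⁿ. (3.64)»; «What is more important we have G′(U′U) = G′(U) + G′(U)V′(A)G′(U′U) = G′(U) + G′(U′U)V′(A)G′(U),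
(3.65) and norms of the second operators on the right-hand sides are small.» — THIS FILE USES THE SECOND EQUALITY OF (3.65)); p. 403 l. 2–5 [PDF 15]
(«Now applying Theorem 3.1 for G′(U), the bound (3.63), the representation (3.64) and Lemma 2.1 of [4] we can prove all the statements (3.42)–(3.47)
of Theorem 3.1 for the operator G′(U′U), of course with different constants, although changes are small.»).
[4] = T. Bałaban, *Propagators and renormalization transformations for lattice gauge theories. II*, Commun. Math. Phys. **96** (1984) 223–250
[Balaban1984PropagatorsII], (2.51)–(2.55) p. 232 («insert Σ_{y″}Δ(y″) = I» device of (2.52)), Lemma 2.1 p. 234.  Pages re-read by this seat (r06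
gen 18) as text `p0009`–`p0011`, `p0014`–`p0015` of the held paper (the text layer of (3.44)/(3.45) is degraded; only the SHAPE «B′₀(ε)(Hölder norm of
λ + |λ|)e^{−δ₀d}» is used, as ONE abstract number `N` per input).  Cell `lit-balaban`, seat r06 (B9 fold owner) gen 18, FILE 38; SKELETON rows
**B9.Thm3.4** × B9.Thm3.1 ((3.44)/(3.45) cells) × B9.Eq3.64 (cells); no row head changes.

WHY THIS FILE (B9-CLOSURE §5 item 3 (N), `G′` side).  FILE 37 transferred Theorem 3.3's (3.44)/(3.45) from `G(U)` to the extended `G(U′U)` by the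
resolvent identity in the order `G(U′U) = G(U) + G(U′U)V(A)G(U)` and the sup block calculus of [4], with abstract devices `input344_of_inverse` /
`input345_of_inverse` valid for ANY two-sided inverse of `Δ − (V⁰ + Σ_kV¹_k∇_k + P₁ + P₂)`.  The `G′`-side is the SAME computation with the concrete
`V′(A)` of (3.60) in GRADIENT form — `conj b V′(A) = (conj b V⁰ − conj b avgOp) + Σ_k conj b (V¹_k)·conj b (∇_k)` (gen 9/16
`B9Eq360VprimeLetters.conj_vPrimeConc_eq_gradForm`, sizes `hasMajorant_V0_vPrime` = (3.61) zeroth order and `B9Eq352GradLetters.hasMajorant_coefLetter`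
= (3.61) first order) — and NO `P₁`, `P₂`: `D_lG′(U′U)D_sλ = D_lG′(U)D_sλ + (D_lG′(U′U))·[V⁰(G′(U)D_sλ) + Σ_kV¹_k(∇_kG′(U)D_sλ)]` (the SECOND equality of
(3.65), here from `Δ′_a(U)G′(U) = 1` and `G′(U′U)(Δ′_a(U) − V′(A)) = 1`, FILE 26), the input-Hölder datum entering only through `D_lG′(U)D_sλ`,
`∇_kG′(U)D_sλ` — (3.44) FOR `U` — while `D_lG′(U′U)` is a sup letter (FILE 26's left-entry clause) and `V⁰`, `V¹_k` are sup letters of size (3.61).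
This is the print's route p. 403 l. 2–5 («Theorem 3.1 for G′(U), the bound (3.63), the representation (3.64) and Lemma 2.1 of [4]»).
* **`thm34_Gp_holderInput_final`** — HYPOTHESES = FILE 26 `B9Thm34SectBFinal.thm34_Gp_final` / FILE 34 §4 `thm34_Gp_holderLeft_final` VERBATIM (the
  `G′`-only data: geometry, (3.37) shapes, the `A`-independent averaging data, Theorem 3.1's (3.24) and (3.42)₁₋₃ for `G′(U)`); CONCLUSION `∃ a₁ > 0
  ∃ B ≧ 0 ∀ α₁ ≦ a₁ ∀ A kF sF …` (FILE 26's premises verbatim): (i) `G′(U′U)` is the two-sided inverse of `Δ′_a(U) − V′(A)` (FILE 26, re-exported) ∧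
  (v′) the (3.44)-type member ∧ (vi′) the (3.45)-type member of `G′(U′U)`, for every left letter `D_l` (`D_lG′(U) ≺ B_GLʲηe^{−δ₀d}`) and right
  letter `D_s` (`G′(U)D_s ≺ B_GLʲηe^{−δ₀d}`): for every block-supported `λ` (`|λ| ≦ M`) and `N ≧ 0` with `|(∇_kG′(U)D_sλ)(z)| ≦ Ne^{−δ₀d(y_z,y′)}`
  (`k ∈ κ ⊕ κ`; in print `N = B′₀(ε)(‖λ‖_ε^{ξ′}(L^{j′}η)^ε + |λ|)`), (v′) `|(D_lG′(U)D_sλ)(z)| ≦ Ne^{−δ₀d}` ⟹ `|(D_lG′(U′U)D_sλ)(x)| ≦ B(N +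
  M)e^{−(4δ₀/5)d}`; (vi′) for `Φ` anchored at `y ∋ p₀` with the (3.43)-left datum for `U` and `N₂ ≧ 0` with `‖Φ(D_lG′(U)D_sλ)‖ ≦ N₂e^{−δ₀d(y,y′)}`:
  `‖Φ(D_lG′(U′U)D_sλ)‖ ≦ B(N₂ + B_h(Lʲη)^{1−γ}c_ζ(Lʲη)⁻¹(N + M))e^{−(4δ₀/5)d}`.  Inputs by name: FILE 26 `thm34_Gp_final` (identities + left-entry
  operator clause at `9δ₀/10`), FILE 34 §4 `thm34_Gp_holderLeft_final` (the (3.43)-left member of `G′(U′U)` per functional), the gradient form and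
  sizes of the concrete `V′(A)`; cascade: letters at `δ₀`, inner composition `(δ₀, 1/20)` to `9δ₀/10`, outer `(δ₀, 1/20)` from `9δ₀/10` to `4δ₀/5`;
  clause constants bounded below a threshold by continuity at `α₁ = 0` (`exists_bound_of_continuousAt`).

HONEST SCOPE.  (a) As in FILES 34–37, Theorem 3.1 FOR `U` enters as INPUTS: (3.24)/(3.42)₁₋₃ as binders, and per input/functional the (3.44)/(3.45)
data of the UNPERTURBED `G′(U)` as ONE non-negative number `N` (resp. `N₂`) — the file does NOT define the `ε`-Hölder norm `‖λ‖_ε^{ξ′}`; whatever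
functional of `λ` is taken for `N`, the conclusion carries the SAME `N` («with different constants only»).  (b) `D_l`, `D_s` arbitrary letters with
the (3.42)₂/(3.42)₃-type entries for `U` (print: `∇_U`, `∇*_U`, «conventional», p. 398).  (c) The (3.44) data are asked for ALL `2d` concrete
first differences `∇_k = conj b (diffLetter T U η⁻¹ k)` (the gradient form of `V′(A)` brings each of them), same `N`.  (d) NOT covered: the `L²`
members (3.46) for the extended operators (B9-CLOSURE §5 item 3 (O)).  (e) No new definition, no named fact, no row head change (B9.Thm3.4 stays
`typed-existing`).

Depends on: `B9Thm34HolderInputG` (FILE 37: `input344_of_inverse`, `input345_of_inverse`), `B9Thm34HolderLeftFinal` (§4 `thm34_Gp_holderLeft_final`),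
`B9Thm34SectBFinal` (`thm34_Gp_final`), `B9Eq360VprimeLetters` (`conj_vPrimeConc_eq_gradForm`, `hasMajorant_V0_vPrime`), `B9Eq352GradLetters`
(`hasMajorant_coefLetter`), `B9Ineq363Vprime` (`cVConc`), `B9Thm34GKernelFinal` (`exists_bound_of_continuousAt`), `B6RandomWalk` (`hasMajorant_zero`),
`B9Eq386Neumann` (`vTotal`) — all used BY NAME.
-/

noncomputable section

namespace Literature.MathematicalPhysics.QuantumFieldTheory.Balaban1983to89.B9Thm34HolderInputGp

open NormedSpace Complex
open Literature.MathematicalPhysics.QuantumFieldTheory.Balaban1983to89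
open Literature.MathematicalPhysics.QuantumFieldTheory.Balaban1983to89.B6RandomWalk (HasMajorant BlockSupp hasMajorant_mono hasMajorant_zero Triangle254 Ineq261)
open Literature.MathematicalPhysics.QuantumFieldTheory.Balaban1983to89.B9Thm34Ext (toB6)
open Literature.MathematicalPhysics.QuantumFieldTheory.Balaban1983to89.B9Ineq347 (ScaleTransfer)
open Literature.MathematicalPhysics.QuantumFieldTheory.Balaban1983to89.B9Eq386Neumann (vTotal)
open Literature.MathematicalPhysics.QuantumFieldTheory.Balaban1983to89.B9Eq39Adjoint
open Literature.MathematicalPhysics.QuantumFieldTheory.Balaban1983to89.B9Eq352DivForm (tauF tauB)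
open Literature.MathematicalPhysics.QuantumFieldTheory.Balaban1983to89.B9Eq352DivFormLetters
open Literature.MathematicalPhysics.QuantumFieldTheory.Balaban1983to89.B9Eq352GradLetters (V0op coefLetter diffLetter hasMajorant_coefLetter)
open Literature.MathematicalPhysics.QuantumFieldTheory.Balaban1983to89.B9Eq360Vprime (gPrimeExtEnd)
open Literature.MathematicalPhysics.QuantumFieldTheory.Balaban1983to89.B9Eq360VprimeLetters (avgOp vPrimeConc conj_vPrimeConc_eq_gradForm hasMajorant_V0_vPrime)
open Literature.MathematicalPhysics.QuantumFieldTheory.Balaban1983to89.B9Ineq363Vprime (cVConc cVConc_nonneg)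
open Literature.MathematicalPhysics.QuantumFieldTheory.Balaban1983to89.B9Ineq385Kernel (exp_rate_mono)
open Literature.MathematicalPhysics.QuantumFieldTheory.Balaban1983to89.B9Thm34GKernelFinal (exists_bound_of_continuousAt)
open Literature.MathematicalPhysics.QuantumFieldTheory.Balaban1983to89.B9Thm34SectBFinal (thm34_Gp_final)
open Literature.MathematicalPhysics.QuantumFieldTheory.Balaban1983to89.B9Thm34HolderLeftFinal (thm34_Gp_holderLeft_final)
open Literature.MathematicalPhysics.QuantumFieldTheory.Balaban1983to89.B9Thm34HolderInputG (input344_of_inverse input345_of_inverse)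

section Final

variable {𝔸 : Type*} [NormedRing 𝔸] [NormedAlgebra ℂ 𝔸] [CompleteSpace 𝔸] {ι : Type} [Fintype ι]
variable (b : Module.Basis ι ℝ 𝔸) {S : Type} {κ : Type} [Fintype κ]
variable (T : κ → Equiv.Perm S) (U : κ → S → 𝔸ˣ)
variable {g : B9.Geometry} [Fintype g.Site] {Rr : ℝ} {H : Prop}

set_option maxHeartbeats 1600000 in
/-- **THEOREM 3.4 × THEOREM 3.1: THE MEMBERS (3.44) AND (3.45) (MIXED SECOND DIFFERENCES, INPUT HÖLDER NORM) FOR THE CONCRETE `G′(U′U)` OF (3.64)**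
(«|(∇_UG′(U)∇*_Uλ)(x)| ≦ B′₀(ε)(…)e^{−δ₀d(y,y′)} for 0 < ε ≦ 1, x ∈ Δ(y), supp λ ⊂ Δ̃(y′)» (3.44) and its Hölder-output twin (3.45), p. 398; for `U′U` by
Theorem 3.4 p. 400 and p. 403 l. 1–9 «we can prove all the statements (3.42)–(3.47) of Theorem 3.1 for the operator G′(U′U), of course with different
constants»).  HYPOTHESES = FILE 26 `thm34_Gp_final` / FILE 34 §4 VERBATIM.  CONCLUSION `∃ a₁ > 0 ∃ B ≧ 0 ∀ α₁ ≦ a₁ ∀ A kF sF …` (FILE 26's premises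
verbatim): (i) `G′(U′U) := gPrimeExtEnd G′(U) (V′(A)G′(U))` is the two-sided inverse of `Δ′_a(U) − V′(A)` (re-exported) ∧, for every left letter `D_l`
(`D_lG′(U) ≺ B_GLʲηe^{−δ₀d}`) and right letter `D_s` (`G′(U)D_s ≺ B_GLʲηe^{−δ₀d}`), every block-supported `λ` (`supp λ ⊂ Δ(y′)`, `|λ| ≦ M`) and every
`N ≧ 0` with THE UNPERTURBED mixed differences `|(∇_kG′(U)D_sλ)(z)| ≦ Ne^{−δ₀d(y_z,y′)}` (`k ∈ κ ⊕ κ`) [(3.44) for `U`, `N = B′₀(ε)(‖λ‖_ε^{ξ′}(L^{j′}η)^ε +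
|λ|)`]: (v′) `|(D_lG′(U)D_sλ)(z)| ≦ Ne^{−δ₀d}` ⟹ `|(D_lG′(U′U)D_sλ)(x)| ≦ B(N + M)e^{−(4δ₀/5)d(y_x,y′)}`; (vi′) for every `ℝ`-linear `𝔸`-valued `Φ`
anchored at `y ∋ p₀`, `γ`, `B_h, c_ζ ≧ 0` with the (3.43)-left datum `‖Φ(D_lG′(U)ν)‖ ≦ B_h(Lʲη)^{1−γ}c_ζe^{−δ₀d(y,y″)}|ν|` for `U` and every `N₂ ≧ 0`
with `‖Φ(D_lG′(U)D_sλ)‖ ≦ N₂e^{−δ₀d(y,y′)}` [(3.45) for `U`]: `‖Φ(D_lG′(U′U)D_sλ)‖ ≦ B(N₂ + B_h(Lʲη)^{1−γ}c_ζ(Lʲη)⁻¹(N + M))e^{−(4δ₀/5)d(y,y′)}`.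
PROOF: FILE 37's devices `input344_of_inverse` / `input345_of_inverse` with `V₃ := conj b V′(A)` in the gradient form `conj_vPrimeConc_eq_gradForm`
(sizes `hasMajorant_V0_vPrime`, `hasMajorant_coefLetter` at the rate `δ₀`; `P₁ = P₂ = 0`), the identities and the left-entry clause of FILE 26
(`D_lG′(U′U) ≺ BLʲηe^{−(9δ₀/10)d}`), FILE 34 §4 (the (3.43)-left member of `G′(U′U)` for `Φ∘D_l`), the cascade `(δ₀, 1/20)`: `9δ₀/10` inside,
`4δ₀/5` outside; clause constants by continuity at `α₁ = 0`.  HONEST SCOPE: module header (a)–(e).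
[cite: Balaban1985BackgroundPropagators, Thm 3.4 p.400 + Thm 3.1 (3.42)–(3.45) pp.397–398 + (3.60)–(3.65) p.402 + p.403 l.1–9 + (3.37) p.396; Balaban1984PropagatorsII, (2.51)–(2.55) p.232 + Lemma 2.1 p.234] -/
theorem thm34_Gp_holderInput_final [Fintype S] [DecidableEq S] [DecidableEq ι] [DecidableEq g.Site] [Nonempty g.Site] (blk : S → g.Site) (d : ℕ)
    (δ₀ BG Cq a₀ d₀ M₂ : ℝ)
    (kQ : g.Site → S → 𝔸 →L[ℝ] 𝔸) (sQ : S → 𝔸 →L[ℝ] 𝔸) (cfun w : g.Site → ℝ)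
    (hBG : 0 < BG) (hCq : 0 ≤ Cq) (ha₀ : 0 ≤ a₀) (hM₂ : 0 ≤ M₂) (hδ₀ : 0 < δ₀)
    -- the multiscale geometry 𝔅 (p. 393, [4] (2.1)–(2.4)) and its axioms
    (hdnn : ∀ a a' : g.Site, 0 ≤ g.dist a a') (htri : Triangle254 (toB6 g Rr H)) (hrefl : ∀ y : g.Site, g.dist y y = 0)
    (hsym : ∀ y y' : g.Site, g.dist y y' = g.dist y' y) (hlen : ∀ y : g.Site, 0 < g.len y) (hlenη : ∀ y : g.Site, g.eta ≤ g.len y)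
    (hη : 0 < g.eta)
    -- [4] Lemma 2.1 (2.61) at the rate `δ₀`, «for every 0 < α < 1», and the p. 398 scale transfer for every exponent
    (h261 : ∀ α : ℝ, 0 < α → α < 1 → Ineq261 d (toB6 g Rr H) δ₀ α)
    (hST : ∀ α : ℝ, 0 < α → ∃ Λ : ℝ, 1 ≤ Λ ∧ ScaleTransfer g δ₀ α Λ (fun a => g.len a) ∧ ScaleTransfer g δ₀ α Λ (fun a => g.len a ^ 2) ∧
      ScaleTransfer g δ₀ α Λ (fun a => (g.len a)⁻¹) ∧ ScaleTransfer g δ₀ α Λ (fun a => (g.len a ^ 2)⁻¹) ∧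
      ScaleTransfer g δ₀ α Λ (fun a => (g.len a ^ 4)⁻¹) ∧ ScaleTransfer g δ₀ α Λ (fun y => g.len y ^ (-(4 : ℝ))))
    (hrepr : ∀ (v : 𝔸) (i : ι), |b.repr v i| ≤ M₂ * ‖v‖)
    (hU1 : ∀ m z, ‖((U m z : 𝔸ˣ) : 𝔸)‖ ≤ 1 ∧ ‖(((U m z)⁻¹ : 𝔸ˣ) : 𝔸)‖ ≤ 1)
    (hd₀B : ∀ μ x, g.dist (blk x) (blk ((T μ).symm x)) ≤ d₀) (hd₀F : ∀ μ x, g.dist (blk x) (blk (T μ x)) ≤ d₀)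
    (hd₀0 : ∀ y : g.Site, g.dist y y ≤ d₀)
    -- the `A`-independent data of the concrete `V′(A)` of (3.60)
    (hw : ∀ y, 0 ≤ w y) (hcard : ∀ y, ((B9Eq360Vprime.block blk y).card : ℝ) * w y ≤ 1)
    (hkQ : ∀ y x, blk x = y → ‖kQ y x‖ ≤ w y) (hsQ : ∀ x, ‖sQ x‖ ≤ 1) (hcfun : ∀ y, |cfun y| ≤ a₀ * (g.len y ^ 2)⁻¹)
    -- THEOREM 3.1 for `G′(U)`: (3.24) `G′(U) = (Δ′_a(U))⁻¹` for the letter `Δ′_a(U)`, and (3.42)₁,₂,₃ at the rate `δ₀`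
    {Δp Gp : Module.End ℝ (S × ι → ℝ)} (hΔpGp : Δp * Gp = 1) (hGpΔp : Gp * Δp = 1)
    (h342_1 : HasMajorant (g := toB6 g Rr H) (fun p : S × ι => blk p.1) Gp
      (fun a a' => BG * g.len a ^ 2 * Real.exp (-(δ₀ * g.dist a a'))))
    (h342_2 : ∀ k : κ ⊕ κ, HasMajorant (g := toB6 g Rr H) (fun p : S × ι => blk p.1)
      (conj b (diffLetter T U ((g.eta : ℂ)⁻¹) k) * Gp) (fun a a' => BG * g.len a * Real.exp (-(δ₀ * g.dist a a'))))
    (h342_3 : ∀ k : κ ⊕ κ, HasMajorant (g := toB6 g Rr H) (fun p : S × ι => blk p.1)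
      (Gp * conj b (diffLetter T U ((g.eta : ℂ)⁻¹) k)) (fun a a' => BG * g.len a * Real.exp (-(δ₀ * g.dist a a')))) :
    ∃ a₁ : ℝ, 0 < a₁ ∧ ∃ B : ℝ, 0 ≤ B ∧
    ∀ (α₁ : ℝ), 0 ≤ α₁ → α₁ ≤ a₁ →
    -- the exponent field `A` in the domain (3.37), read blockwise, and the `A`-dependent (3.59) data `kF`, `sF`
    ∀ (A : κ → S → 𝔸) (kF : g.Site → S → 𝔸 →L[ℝ] 𝔸) (sF : S → 𝔸 →L[ℝ] 𝔸),
      (∀ y x, blk x = y → ‖kF y x‖ ≤ Cq * α₁ * w y) → (∀ x, ‖sF x‖ ≤ Cq * α₁) →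
      (∀ ν k x, ‖((g.eta : ℂ)⁻¹) • covDstar T U ν (A k) x‖ ≤ α₁ * (g.len (blk x) ^ 2)⁻¹) →
      (∀ μ ν x, ‖((g.eta : ℂ)⁻¹) • covD T U μ (A ν) x‖ ≤ α₁ * (g.len (blk x) ^ 2)⁻¹) →
      (∀ μ x, ‖((g.eta : ℂ)⁻¹) • covDstar T U μ (tauB T U μ (A μ)) x‖ ≤ α₁ * (g.len (blk x) ^ 2)⁻¹) →
      (∀ k x, ‖A k x‖ ≤ α₁ * (g.len (blk x))⁻¹) → (∀ ν k x, ‖tauB T U ν (A k) x‖ ≤ α₁ * (g.len (blk x))⁻¹) →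
      -- (i) `G′(U′U)` = the two-sided inverse of `Δ′_a(U) − V′(A)` (FILE 26, re-exported)
      (Δp - (conj b (vPrimeConc T U g.eta A blk kQ kF sQ sF cfun))) * (gPrimeExtEnd Gp (conj b (vPrimeConc T U g.eta A blk kQ kF sQ sF cfun) * Gp)) = 1 ∧
      (gPrimeExtEnd Gp (conj b (vPrimeConc T U g.eta A blk kQ kF sQ sF cfun) * Gp)) * (Δp - (conj b (vPrimeConc T U g.eta A blk kQ kF sQ sF cfun))) = 1 ∧
      -- (v′) NEW: Theorem 3.1's (3.44)-type member (input Hölder norm, sup output) of `G′(U′U)`, for every pair of letters `D_l` (left, with the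
      -- (3.42)₂-type entry `D_lG′(U) ≺ B_GLʲηe^{−δ₀d}`) and `D_s` (right, with the (3.42)₃-type entry `G′(U)D_s ≺ B_GLʲηe^{−δ₀d}`)
      (∀ (Dl Ds : Module.End ℝ (S × ι → ℝ)),
        HasMajorant (g := toB6 g Rr H) (fun p : S × ι => blk p.1) (Dl * Gp) (fun a a' => BG * g.len a * Real.exp (-(δ₀ * g.dist a a'))) →
        HasMajorant (g := toB6 g Rr H) (fun p : S × ι => blk p.1) (Gp * Ds) (fun a a' => BG * g.len a * Real.exp (-(δ₀ * g.dist a a'))) →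
      ∀ (y' : g.Site) (μ : S × ι → ℝ) (M : ℝ), BlockSupp (g := toB6 g Rr H) (fun p : S × ι => blk p.1) μ y' M →
      ∀ (N : ℝ), 0 ≤ N →
        -- (3.44) FOR `U`, THIS INPUT: the mixed second differences of `G′(U)λ` (in print `N = B′₀(ε)(‖λ‖_ε^{ξ′}(L^{j′}η)^ε + |λ|)`)
        (∀ (k : κ ⊕ κ) (z : S × ι), |(((conj b (diffLetter T U ((g.eta : ℂ)⁻¹) k)) * Gp * Ds) μ) z| ≤ N * Real.exp (-(δ₀ * g.dist (blk z.1) y'))) →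
        (∀ z : S × ι, |((Dl * Gp * Ds) μ) z| ≤ N * Real.exp (-(δ₀ * g.dist (blk z.1) y'))) →
        ∀ x : S × ι, |((Dl * (gPrimeExtEnd Gp (conj b (vPrimeConc T U g.eta A blk kQ kF sQ sF cfun) * Gp)) * Ds) μ) x| ≤ B * (N + M) * Real.exp (-(4 / 5 * δ₀ * g.dist (blk x.1) y'))) ∧
      -- (vi′) NEW: Theorem 3.1's (3.45)-type member (input Hölder norm, Hölder output through a transported quotient functional `Φ`, FILE 34 §3)
      (∀ (Dl Ds : Module.End ℝ (S × ι → ℝ)),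
        HasMajorant (g := toB6 g Rr H) (fun p : S × ι => blk p.1) (Dl * Gp) (fun a a' => BG * g.len a * Real.exp (-(δ₀ * g.dist a a'))) →
        HasMajorant (g := toB6 g Rr H) (fun p : S × ι => blk p.1) (Gp * Ds) (fun a a' => BG * g.len a * Real.exp (-(δ₀ * g.dist a a'))) →
      ∀ (Φ : (S → 𝔸) →ₗ[ℝ] 𝔸) (y : g.Site) (p₀ : S × ι), blk p₀.1 = y →
      ∀ (γ Bh cζ : ℝ), 0 ≤ Bh → 0 ≤ cζ →
        -- (3.43) with the derivative `D_l` on the left FOR `U`, this functional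
        (∀ (y'' : g.Site) (ν : S × ι → ℝ) (C : ℝ), BlockSupp (g := toB6 g Rr H) (fun p : S × ι => blk p.1) ν y'' C →
          ‖Φ ((coordEquiv b).symm (Dl (Gp ν)))‖ ≤ Bh * g.len y ^ (1 - γ) * cζ * Real.exp (-(δ₀ * g.dist y y'')) * C) →
      ∀ (y' : g.Site) (μ : S × ι → ℝ) (M : ℝ), BlockSupp (g := toB6 g Rr H) (fun p : S × ι => blk p.1) μ y' M →
      ∀ (N : ℝ), 0 ≤ N →
        (∀ (k : κ ⊕ κ) (z : S × ι), |(((conj b (diffLetter T U ((g.eta : ℂ)⁻¹) k)) * Gp * Ds) μ) z| ≤ N * Real.exp (-(δ₀ * g.dist (blk z.1) y'))) →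
      -- (3.45) FOR `U`, THIS INPUT AND THIS FUNCTIONAL (in print `N₂ = B′₀(ε,β)(Lʲη)^{−β}(‖ζ‖_β^ξ + |ζ|)(…)`)
      ∀ (N₂ : ℝ), 0 ≤ N₂ → ‖Φ ((coordEquiv b).symm ((Dl * Gp * Ds) μ))‖ ≤ N₂ * Real.exp (-(δ₀ * g.dist y y')) →
        ‖Φ ((coordEquiv b).symm ((Dl * (gPrimeExtEnd Gp (conj b (vPrimeConc T U g.eta A blk kQ kF sQ sF cfun) * Gp)) * Ds) μ))‖ ≤
          B * (N₂ + Bh * g.len y ^ (1 - γ) * cζ * (g.len y)⁻¹ * (N + M)) * Real.exp (-(4 / 5 * δ₀ * g.dist y y'))) := by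
  classical
  -- FILE 26 (identities, left-entry operator clause) and FILE 34 §4 (the (3.43)-left member of `G′(U′U)` per functional)
  obtain ⟨a₁, ha₁, B', hB', H26⟩ := thm34_Gp_final (Rr := Rr) (H := H) b T U blk d δ₀ BG Cq a₀ d₀ M₂ kQ sQ cfun w hBG hCq ha₀ hM₂ hδ₀ hdnn
    htri hrefl hsym hlen hlenη hη h261 hST hrepr hU1 hd₀B hd₀F hd₀0 hw hcard hkQ hsQ hcfun hΔpGp hGpΔp h342_1 h342_2 h342_3
  obtain ⟨a₃, ha₃, B₃, hB₃, H34⟩ := thm34_Gp_holderLeft_final (Rr := Rr) (H := H) b T U blk d δ₀ BG Cq a₀ d₀ M₂ kQ sQ cfun w hBG hCq ha₀ hM₂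
    hδ₀ hdnn htri hrefl hsym hlen hlenη hη h261 hST hrepr hU1 hd₀B hd₀F hd₀0 hw hcard hkQ hsQ hcfun hΔpGp hGpΔp h342_1 h342_2 h342_3
  -- the geometry of the cascade: exponents `1/20` at the printed rate `δ₀`
  obtain ⟨Λ, hΛ, hT1, -, hT1i, -, -, -⟩ := hST (1 / 20) (by norm_num)
  have hΛ0 : 0 ≤ Λ := zero_le_one.trans hΛ
  have h261β : Ineq261 d (toB6 g Rr H) δ₀ (1 / 20) := h261 _ (by norm_num) (by norm_num)
  have hc₂ : 0 ≤ (B6.c1 d δ₀ (1 / 20)) := B6RandomWalk.c1_nonneg d δ₀ (1 / 20)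
  have hρ0 : (0 : ℝ) ≤ 9 / 10 * δ₀ := by linarith only [hδ₀]
  have hr : 9 / 10 * δ₀ + (1 / 20 + 1 / 20) * δ₀ ≤ δ₀ := by linarith only [hδ₀]
  have hρ₃ : (0 : ℝ) ≤ 4 / 5 * δ₀ := by linarith only [hδ₀]
  have hρ₃r : 4 / 5 * δ₀ + (1 / 20 + 1 / 20) * δ₀ ≤ 9 / 10 * δ₀ := by linarith only [hδ₀]
  have hρ₃ρ : 4 / 5 * δ₀ ≤ 9 / 10 * δ₀ := by linarith only [hδ₀]
  have hSb : 0 ≤ ∑ i, ‖b i‖ := Finset.sum_nonneg fun i _ => norm_nonneg _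
  have hE₀ : 0 ≤ (Real.exp (δ₀ * d₀)) := Real.exp_nonneg _
  -- «of course with different constants» (p. 403): the two clause constants are continuous at `α₁ = 0`, hence bounded below a threshold
  obtain ⟨KB₁, ε₁, hKB₁, hε₁, hF1⟩ := exists_bound_of_continuousAt
    (f := fun α₁ : ℝ => (1 + α₁ * B' * Λ * (B6.c1 d δ₀ (1 / 20)) * (cVConc (Fintype.card κ) 1 α₁ a₀ Cq M₂ (∑ i, ‖b i‖) (Real.exp (δ₀ * d₀))) * (B6.c1 d δ₀ (1 / 20))) + (α₁ * B' * Λ * (B6.c1 d δ₀ (1 / 20)) * BG * Λ * (B6.c1 d δ₀ (1 / 20)) * ((cVConc (Fintype.card κ) 1 α₁ a₀ Cq M₂ (∑ i, ‖b i‖) (Real.exp (δ₀ * d₀))) + 0 + 0)))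
    (by
      unfold cVConc B9Eq360VprimeLetters.cBConc
      fun_prop)
  obtain ⟨KB₂, ε₂, hKB₂, hε₂, hF2⟩ := exists_bound_of_continuousAt
    (f := fun α₁ : ℝ => 1 + (B₃ * Λ * (B6.c1 d δ₀ (1 / 20)) * (α₁ * (B6.c1 d δ₀ (1 / 20)) * (((cVConc (Fintype.card κ) 1 α₁ a₀ Cq M₂ (∑ i, ‖b i‖) (Real.exp (δ₀ * d₀))) + 0 + 0) * BG * Λ + (cVConc (Fintype.card κ) 1 α₁ a₀ Cq M₂ (∑ i, ‖b i‖) (Real.exp (δ₀ * d₀)))))))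
    (by
      unfold cVConc B9Eq360VprimeLetters.cBConc
      fun_prop)
  have hBtot : 0 ≤ KB₁ + KB₂ := add_nonneg hKB₁ hKB₂
  refine ⟨min (min (min a₁ a₃) (1 / 4)) (min (ε₁ / 2) (ε₂ / 2)),
    lt_min (lt_min (lt_min ha₁ ha₃) (by norm_num)) (lt_min (half_pos hε₁) (half_pos hε₂)), KB₁ + KB₂, hBtot, ?_⟩
  intro α₁ hα₁0 hα₁1 A kF sF hkF hsF h337B h337F h337Bτ hA hAτB
  have hm₁ : min (min (min a₁ a₃) (1 / 4)) (min (ε₁ / 2) (ε₂ / 2)) ≤ a₁ := (min_le_left _ _).trans ((min_le_left _ _).trans (min_le_left _ _))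
  have hm₃ : min (min (min a₁ a₃) (1 / 4)) (min (ε₁ / 2) (ε₂ / 2)) ≤ a₃ := (min_le_left _ _).trans ((min_le_left _ _).trans (min_le_right _ _))
  have hmq : min (min (min a₁ a₃) (1 / 4)) (min (ε₁ / 2) (ε₂ / 2)) ≤ 1 / 4 := (min_le_left _ _).trans (min_le_right _ _)
  have hmε₁ : min (min (min a₁ a₃) (1 / 4)) (min (ε₁ / 2) (ε₂ / 2)) ≤ ε₁ / 2 := (min_le_right _ _).trans (min_le_left _ _)
  have hmε₂ : min (min (min a₁ a₃) (1 / 4)) (min (ε₁ / 2) (ε₂ / 2)) ≤ ε₂ / 2 := (min_le_right _ _).trans (min_le_right _ _)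
  have hα₁a : α₁ ≤ a₁ := hα₁1.trans hm₁
  have hα₁c : α₁ ≤ a₃ := hα₁1.trans hm₃
  have hα₁q : α₁ ≤ 1 / 4 := hα₁1.trans hmq
  have habs : |α₁| = α₁ := abs_of_nonneg hα₁0
  have hα₁ε₁ : |α₁| < ε₁ := by rw [habs]; linarith only [hα₁1, hmε₁, hε₁]
  have hα₁ε₂ : |α₁| < ε₂ := by rw [habs]; linarith only [hα₁1, hmε₂, hε₂]
  -- FILE 26 at this `α₁`, `A`: identities and the left-entry operator clause; FILE 34 §4: the (3.43)-left clause for `G′(U′U)`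
  obtain ⟨e1, e2, hGpL, -⟩ := H26 α₁ hα₁0 hα₁a A kF sF hkF hsF h337B h337F h337Bτ hA hAτB
  have hGLp := H34 α₁ hα₁0 hα₁c A kF sF hkF hsF h337B h337F h337Bτ hA hAτB
  -- the shapes in which the letter lemmas read (3.37), the transports and the stencil geometry; «η·α₁(Lʲη)⁻¹ ≦ 1/4»
  have hsmall : ∀ z : g.Site, g.eta * (α₁ * (g.len z)⁻¹) ≤ 1 / 4 := fun z => by
    have hq : g.eta * (g.len z)⁻¹ ≤ 1 := by
      rw [← div_eq_mul_inv]; exact (div_le_one (hlen z)).mpr (hlenη z)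
    calc g.eta * (α₁ * (g.len z)⁻¹) = α₁ * (g.eta * (g.len z)⁻¹) := by ring
      _ ≤ α₁ * 1 := mul_le_mul_of_nonneg_left hq hα₁0
      _ ≤ 1 / 4 := by linarith only [hα₁q]
  have hA' : ∀ μ x, ‖A μ x‖ ≤ α₁ * (g.len (blk x))⁻¹ ∧ ‖tauB T U μ (A μ) x‖ ≤ α₁ * (g.len (blk x))⁻¹ :=
    fun μ x => ⟨hA μ x, hAτB μ μ x⟩
  have h337s' : ∀ μ x, ‖((g.eta : ℂ)⁻¹) • covDstar T U μ (A μ) x‖ ≤ α₁ * (g.len (blk x) ^ 2)⁻¹ := fun μ x => h337B μ μ x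
  have hd₀' : ∀ μ x, g.dist (blk x) (blk (T μ x)) ≤ d₀ ∧ g.dist (blk x) (blk ((T μ).symm x)) ≤ d₀ :=
    fun μ x => ⟨hd₀F μ x, hd₀B μ x⟩
  -- the concrete `V′(A)` of (3.60): gradient form, the zeroth-order size at `cVConc`, the first-order sizes, no `P₁`, `P₂`
  have hV₃ := conj_vPrimeConc_eq_gradForm b T U g.eta A blk kQ kF sQ sF cfun
  have hcC0 : 0 ≤ ((2 + 8 * (1 : ℝ) ^ 2 * α₁) * Fintype.card κ + a₀ * Cq * (2 + Cq * α₁)) * M₂ * (∑ i, ‖b i‖) * (Real.exp (δ₀ * d₀)) := by positivity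
  have hcV : 0 ≤ (cVConc (Fintype.card κ) 1 α₁ a₀ Cq M₂ (∑ i, ‖b i‖) (Real.exp (δ₀ * d₀))) := cVConc_nonneg hα₁0 ha₀ hCq hM₂ hSb hE₀
  have hV0 : HasMajorant (g := toB6 g Rr H) (fun p : S × ι => blk p.1)
      (conj b (V0op T U g.eta A) - conj b (avgOp blk kQ kF sQ sF cfun))
      (fun y y' => (cVConc (Fintype.card κ) 1 α₁ a₀ Cq M₂ (∑ i, ‖b i‖) (Real.exp (δ₀ * d₀))) * α₁ * (g.len y ^ 2)⁻¹ * Real.exp (-(δ₀ * g.dist y y'))) := by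
    refine hasMajorant_mono (g := toB6 g Rr H) _
      (hasMajorant_V0_vPrime b T U blk hη A kQ kF sQ sF cfun w 1 d₀ δ₀ M₂ α₁ Cq a₀ hα₁0 hδ₀.le hM₂ hrepr hlen hsmall hA' h337s' hU1
        hd₀' hd₀0 hw hcard hCq ha₀ hkQ hkF hsQ hsF hcfun) fun y y' => ?_
    have hw2 : 0 ≤ (g.len y ^ 2)⁻¹ := inv_nonneg.mpr (sq_nonneg _)
    have hε : 0 ≤ Real.exp (-(δ₀ * g.dist y y')) := Real.exp_nonneg _
    have hle : ((2 + 8 * (1 : ℝ) ^ 2 * α₁) * Fintype.card κ + a₀ * Cq * (2 + Cq * α₁)) * M₂ * (∑ i, ‖b i‖) * (Real.exp (δ₀ * d₀)) ≤ (cVConc (Fintype.card κ) 1 α₁ a₀ Cq M₂ (∑ i, ‖b i‖) (Real.exp (δ₀ * d₀))) := by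
      have hcB : 0 ≤ B9Eq360VprimeLetters.cBConc (Fintype.card κ) M₂ (∑ i, ‖b i‖) (Real.exp (δ₀ * d₀)) := by
        unfold B9Eq360VprimeLetters.cBConc; positivity
      unfold cVConc; linarith
    gcongr
  have hV1 : ∀ k ∈ (Finset.univ : Finset (κ ⊕ κ)), HasMajorant (g := toB6 g Rr H) (fun p : S × ι => blk p.1) (conj b (coefLetter T U A k))
      (fun y y' => (2 * M₂ * (∑ i, ‖b i‖) * Real.exp (δ₀ * d₀)) * α₁ * (g.len y)⁻¹ * Real.exp (-(δ₀ * g.dist y y'))) :=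
    fun k _ => hasMajorant_coefLetter b T U blk A d₀ δ₀ M₂ α₁ hα₁0 hδ₀.le hM₂ hrepr hlen hA' hd₀0 k
  have hcK0 : ∀ k ∈ (Finset.univ : Finset (κ ⊕ κ)), (0 : ℝ) ≤ (2 * M₂ * (∑ i, ‖b i‖) * Real.exp (δ₀ * d₀)) := fun k _ => by positivity
  have hsum : ∑ _k ∈ (Finset.univ : Finset (κ ⊕ κ)), (2 * M₂ * (∑ i, ‖b i‖) * Real.exp (δ₀ * d₀)) ≤ (cVConc (Fintype.card κ) 1 α₁ a₀ Cq M₂ (∑ i, ‖b i‖) (Real.exp (δ₀ * d₀))) := by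
    rw [Finset.sum_const, Finset.card_univ, Fintype.card_sum, nsmul_eq_mul, Nat.cast_add, cVConc, B9Eq360VprimeLetters.cBConc]
    nlinarith [hcC0]
  have hP : HasMajorant (g := toB6 g Rr H) (fun p : S × ι => blk p.1) (0 : Module.End ℝ (S × ι → ℝ))
      (fun a a' => 0 * α₁ * (g.len a ^ 2)⁻¹ * Real.exp (-(δ₀ * g.dist a a'))) :=
    hasMajorant_mono (g := toB6 g Rr H) _ (hasMajorant_zero (g := toB6 g Rr H) _) fun a a' => le_of_eq (by ring)
  -- `G′(U′U)(Δ′_a(U) − V′(A)) = 1` with `V′(A) = vTotal V′(A) 0 0`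
  have hE : (gPrimeExtEnd Gp (conj b (vPrimeConc T U g.eta A blk kQ kF sQ sF cfun) * Gp)) * (Δp - vTotal (conj b (vPrimeConc T U g.eta A blk kQ kF sQ sF cfun)) (0 : Module.End ℝ (S × ι → ℝ)) 0) = 1 := by
    simpa only [vTotal, add_zero] using e2
  -- common non-negativities and the clause constants at this `α₁`
  have hw1 : ∀ a : g.Site, 0 ≤ g.len a := fun a => (hlen a).le
  have hK1 := hF1 α₁ hα₁ε₁
  have hK2 := hF2 α₁ hα₁ε₂
  have hcoefN : 0 ≤ (1 + α₁ * B' * Λ * (B6.c1 d δ₀ (1 / 20)) * (cVConc (Fintype.card κ) 1 α₁ a₀ Cq M₂ (∑ i, ‖b i‖) (Real.exp (δ₀ * d₀))) * (B6.c1 d δ₀ (1 / 20))) := by positivity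
  have hcoefM : 0 ≤ (α₁ * B' * Λ * (B6.c1 d δ₀ (1 / 20)) * BG * Λ * (B6.c1 d δ₀ (1 / 20)) * ((cVConc (Fintype.card κ) 1 α₁ a₀ Cq M₂ (∑ i, ‖b i‖) (Real.exp (δ₀ * d₀))) + 0 + 0)) := by positivity
  have hcoefVI : 0 ≤ (B₃ * Λ * (B6.c1 d δ₀ (1 / 20)) * (α₁ * (B6.c1 d δ₀ (1 / 20)) * (((cVConc (Fintype.card κ) 1 α₁ a₀ Cq M₂ (∑ i, ‖b i‖) (Real.exp (δ₀ * d₀))) + 0 + 0) * BG * Λ + (cVConc (Fintype.card κ) 1 α₁ a₀ Cq M₂ (∑ i, ‖b i‖) (Real.exp (δ₀ * d₀)))))) := by positivity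
  refine ⟨e1, e2, ?_, ?_⟩
  · -- (v′) the (3.44)-type member
    intro Dl Ds hDlG hGDs y' μ M hμ N hN h344 h344l x
    have hM : 0 ≤ M := hμ.nonneg
    have hDlE := hGpL Dl (fun a => g.len a) hw1 hDlG
    have hdev := input344_of_inverse (R := Rr) (H := H) (fun p : S × ι => blk p.1) d (Finset.univ : Finset (κ ⊕ κ))
      δ₀ δ₀ (1 / 20) (1 / 20) (9 / 10 * δ₀) Λ (cVConc (Fintype.card κ) 1 α₁ a₀ Cq M₂ (∑ i, ‖b i‖) (Real.exp (δ₀ * d₀))) 0 0 α₁ BG δ₀ (1 / 20) (1 / 20) Λ (9 / 10 * δ₀) (4 / 5 * δ₀) B'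
      (fun _ => (2 * M₂ * (∑ i, ‖b i‖) * Real.exp (δ₀ * d₀)))
      hBG.le hcV le_rfl le_rfl hα₁0 hΛ0 hρ0 (by norm_num) (by norm_num) hδ₀.le hr hcK0 hsum hΛ0 hB' hρ₃ hρ₃r hρ₃ρ hdnn htri hlen h261β h261β hT1 hT1i
      (P₁ := 0) (P₂ := 0)
      (V1 := fun k => conj b (coefLetter T U A k))
      (D := fun k => conj b (diffLetter T U ((g.eta : ℂ)⁻¹) k))
      hV₃ hΔpGp hE hV0 hV1 hP hP hGDs hDlE y' μ M hμ N hN (fun k _ z => h344 k z) h344l x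
    refine hdev.trans ?_
    have hEx : 0 ≤ Real.exp (-(4 / 5 * δ₀ * g.dist (blk x.1) y')) := Real.exp_nonneg _
    have h1 : N * (1 + α₁ * B' * Λ * (B6.c1 d δ₀ (1 / 20)) * (cVConc (Fintype.card κ) 1 α₁ a₀ Cq M₂ (∑ i, ‖b i‖) (Real.exp (δ₀ * d₀))) * (B6.c1 d δ₀ (1 / 20))) ≤ N * ((1 + α₁ * B' * Λ * (B6.c1 d δ₀ (1 / 20)) * (cVConc (Fintype.card κ) 1 α₁ a₀ Cq M₂ (∑ i, ‖b i‖) (Real.exp (δ₀ * d₀))) * (B6.c1 d δ₀ (1 / 20))) + (α₁ * B' * Λ * (B6.c1 d δ₀ (1 / 20)) * BG * Λ * (B6.c1 d δ₀ (1 / 20)) * ((cVConc (Fintype.card κ) 1 α₁ a₀ Cq M₂ (∑ i, ‖b i‖) (Real.exp (δ₀ * d₀))) + 0 + 0))) := mul_le_mul_of_nonneg_left (le_add_of_nonneg_right hcoefM) hN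
    have h2 : M * (α₁ * B' * Λ * (B6.c1 d δ₀ (1 / 20)) * BG * Λ * (B6.c1 d δ₀ (1 / 20)) * ((cVConc (Fintype.card κ) 1 α₁ a₀ Cq M₂ (∑ i, ‖b i‖) (Real.exp (δ₀ * d₀))) + 0 + 0)) ≤ M * ((1 + α₁ * B' * Λ * (B6.c1 d δ₀ (1 / 20)) * (cVConc (Fintype.card κ) 1 α₁ a₀ Cq M₂ (∑ i, ‖b i‖) (Real.exp (δ₀ * d₀))) * (B6.c1 d δ₀ (1 / 20))) + (α₁ * B' * Λ * (B6.c1 d δ₀ (1 / 20)) * BG * Λ * (B6.c1 d δ₀ (1 / 20)) * ((cVConc (Fintype.card κ) 1 α₁ a₀ Cq M₂ (∑ i, ‖b i‖) (Real.exp (δ₀ * d₀))) + 0 + 0))) := mul_le_mul_of_nonneg_left (le_add_of_nonneg_left hcoefN) hM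
    have h3 : (N + M) * ((1 + α₁ * B' * Λ * (B6.c1 d δ₀ (1 / 20)) * (cVConc (Fintype.card κ) 1 α₁ a₀ Cq M₂ (∑ i, ‖b i‖) (Real.exp (δ₀ * d₀))) * (B6.c1 d δ₀ (1 / 20))) + (α₁ * B' * Λ * (B6.c1 d δ₀ (1 / 20)) * BG * Λ * (B6.c1 d δ₀ (1 / 20)) * ((cVConc (Fintype.card κ) 1 α₁ a₀ Cq M₂ (∑ i, ‖b i‖) (Real.exp (δ₀ * d₀))) + 0 + 0))) ≤ (N + M) * (KB₁ + KB₂) :=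
      mul_le_mul_of_nonneg_left (hK1.trans (le_add_of_nonneg_right hKB₂)) (add_nonneg hN hM)
    have h4 : N * (1 + α₁ * B' * Λ * (B6.c1 d δ₀ (1 / 20)) * (cVConc (Fintype.card κ) 1 α₁ a₀ Cq M₂ (∑ i, ‖b i‖) (Real.exp (δ₀ * d₀))) * (B6.c1 d δ₀ (1 / 20))) + M * (α₁ * B' * Λ * (B6.c1 d δ₀ (1 / 20)) * BG * Λ * (B6.c1 d δ₀ (1 / 20)) * ((cVConc (Fintype.card κ) 1 α₁ a₀ Cq M₂ (∑ i, ‖b i‖) (Real.exp (δ₀ * d₀))) + 0 + 0)) ≤ (KB₁ + KB₂) * (N + M) := by linarith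
    exact mul_le_mul_of_nonneg_right h4 hEx
  · -- (vi′) the (3.45)-type member
    intro Dl Ds hDlG hGDs Φ y p₀ hp₀ γ Bh cζ hBh hcζ h343 y' μ M hμ N hN h344 N₂ hN₂ h345
    have hM : 0 ≤ M := hμ.nonneg
    have hA₃ : 0 ≤ B₃ * Bh * g.len y ^ (1 - γ) * cζ := mul_nonneg (mul_nonneg (mul_nonneg hB₃ hBh) (Real.rpow_nonneg (hlen y).le _)) hcζ
    -- FILE 34 §4: the (3.43)-left member of `G′(U′U)` for the functional `Φ ∘ coord⁻¹ ∘ D_l`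
    have hΨE : ∀ (y'' : g.Site) (ν : S × ι → ℝ) (C : ℝ), BlockSupp (g := toB6 g Rr H) (fun p : S × ι => blk p.1) ν y'' C →
        ‖(Φ ∘ₗ (coordEquiv (S := S) b).symm.toLinearMap ∘ₗ Dl) ((gPrimeExtEnd Gp (conj b (vPrimeConc T U g.eta A blk kQ kF sQ sF cfun) * Gp)) ν)‖ ≤
          B₃ * Bh * g.len y ^ (1 - γ) * cζ * Real.exp (-(9 / 10 * δ₀ * g.dist y y'')) * C := fun y'' ν C hν => by
      simpa only [LinearMap.coe_comp, Function.comp_apply, LinearEquiv.coe_toLinearMap] using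
        hGLp Dl Φ y p₀ hp₀ γ Bh cζ hBh hcζ h343 y'' ν C hν
    have hdev := input345_of_inverse (R := Rr) (H := H) (fun p : S × ι => blk p.1) d (Finset.univ : Finset (κ ⊕ κ))
      δ₀ δ₀ (1 / 20) (1 / 20) (9 / 10 * δ₀) Λ (cVConc (Fintype.card κ) 1 α₁ a₀ Cq M₂ (∑ i, ‖b i‖) (Real.exp (δ₀ * d₀))) 0 0 α₁ BG δ₀ (1 / 20) (1 / 20) Λ (9 / 10 * δ₀) (4 / 5 * δ₀)
      (B₃ * Bh * g.len y ^ (1 - γ) * cζ) (fun _ => (2 * M₂ * (∑ i, ‖b i‖) * Real.exp (δ₀ * d₀)))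
      hBG.le hcV le_rfl le_rfl hα₁0 hΛ0 hρ0 (by norm_num) (by norm_num) hδ₀.le hr hcK0 hsum hΛ0 hA₃ hρ₃ hρ₃r hρ₃ρ hdnn htri hlen h261β h261β hT1 hT1i
      (P₁ := 0) (P₂ := 0)
      (V1 := fun k => conj b (coefLetter T U A k))
      (D := fun k => conj b (diffLetter T U ((g.eta : ℂ)⁻¹) k))
      hV₃ hΔpGp hE hV0 hV1 hP hP hGDs (Φ ∘ₗ (coordEquiv (S := S) b).symm.toLinearMap ∘ₗ Dl) y hΨE y' μ M hμ N hN
      (fun k _ z => h344 k z) N₂ hN₂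
      (by simpa only [LinearMap.coe_comp, Function.comp_apply, LinearEquiv.coe_toLinearMap, Module.End.mul_apply] using h345)
    have hdev' : ‖Φ ((coordEquiv b).symm ((Dl * (gPrimeExtEnd Gp (conj b (vPrimeConc T U g.eta A blk kQ kF sQ sF cfun) * Gp)) * Ds) μ))‖ ≤
        (N₂ + B₃ * Bh * g.len y ^ (1 - γ) * cζ * Λ * (B6.c1 d δ₀ (1 / 20)) * (g.len y)⁻¹ *
          (α₁ * (B6.c1 d δ₀ (1 / 20)) * (((cVConc (Fintype.card κ) 1 α₁ a₀ Cq M₂ (∑ i, ‖b i‖) (Real.exp (δ₀ * d₀))) + 0 + 0) * BG * Λ * M + (cVConc (Fintype.card κ) 1 α₁ a₀ Cq M₂ (∑ i, ‖b i‖) (Real.exp (δ₀ * d₀))) * N))) *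
        Real.exp (-(4 / 5 * δ₀ * g.dist y y')) := by
      simpa only [LinearMap.coe_comp, Function.comp_apply, LinearEquiv.coe_toLinearMap, Module.End.mul_apply] using hdev
    refine hdev'.trans ?_
    have hEx : 0 ≤ Real.exp (-(4 / 5 * δ₀ * g.dist y y')) := Real.exp_nonneg _
    have hS : 0 ≤ Bh * g.len y ^ (1 - γ) * cζ * (g.len y)⁻¹ * (N + M) :=
      mul_nonneg (mul_nonneg (mul_nonneg (mul_nonneg hBh (Real.rpow_nonneg (hlen y).le _)) hcζ) (inv_nonneg.mpr (hlen y).le))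
        (add_nonneg hN hM)
    have hQq : α₁ * (B6.c1 d δ₀ (1 / 20)) * (((cVConc (Fintype.card κ) 1 α₁ a₀ Cq M₂ (∑ i, ‖b i‖) (Real.exp (δ₀ * d₀))) + 0 + 0) * BG * Λ * M + (cVConc (Fintype.card κ) 1 α₁ a₀ Cq M₂ (∑ i, ‖b i‖) (Real.exp (δ₀ * d₀))) * N) ≤ (α₁ * (B6.c1 d δ₀ (1 / 20)) * (((cVConc (Fintype.card κ) 1 α₁ a₀ Cq M₂ (∑ i, ‖b i‖) (Real.exp (δ₀ * d₀))) + 0 + 0) * BG * Λ + (cVConc (Fintype.card κ) 1 α₁ a₀ Cq M₂ (∑ i, ‖b i‖) (Real.exp (δ₀ * d₀))))) * (N + M) := by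
      have i1 : ((cVConc (Fintype.card κ) 1 α₁ a₀ Cq M₂ (∑ i, ‖b i‖) (Real.exp (δ₀ * d₀))) + 0 + 0) * BG * Λ * M ≤ ((cVConc (Fintype.card κ) 1 α₁ a₀ Cq M₂ (∑ i, ‖b i‖) (Real.exp (δ₀ * d₀))) + 0 + 0) * BG * Λ * (N + M) :=
        mul_le_mul_of_nonneg_left (le_add_of_nonneg_left hN) (by positivity)
      have i2 : (cVConc (Fintype.card κ) 1 α₁ a₀ Cq M₂ (∑ i, ‖b i‖) (Real.exp (δ₀ * d₀))) * N ≤ (cVConc (Fintype.card κ) 1 α₁ a₀ Cq M₂ (∑ i, ‖b i‖) (Real.exp (δ₀ * d₀))) * (N + M) := mul_le_mul_of_nonneg_left (le_add_of_nonneg_right hM) hcV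
      have i3 := add_le_add i1 i2
      have e : (α₁ * (B6.c1 d δ₀ (1 / 20)) * (((cVConc (Fintype.card κ) 1 α₁ a₀ Cq M₂ (∑ i, ‖b i‖) (Real.exp (δ₀ * d₀))) + 0 + 0) * BG * Λ + (cVConc (Fintype.card κ) 1 α₁ a₀ Cq M₂ (∑ i, ‖b i‖) (Real.exp (δ₀ * d₀))))) * (N + M) = α₁ * (B6.c1 d δ₀ (1 / 20)) * (((cVConc (Fintype.card κ) 1 α₁ a₀ Cq M₂ (∑ i, ‖b i‖) (Real.exp (δ₀ * d₀))) + 0 + 0) * BG * Λ * (N + M) + (cVConc (Fintype.card κ) 1 α₁ a₀ Cq M₂ (∑ i, ‖b i‖) (Real.exp (δ₀ * d₀))) * (N + M)) := by ring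
      rw [e]
      exact mul_le_mul_of_nonneg_left i3 (mul_nonneg hα₁0 hc₂)
    have h1 : B₃ * Bh * g.len y ^ (1 - γ) * cζ * Λ * (B6.c1 d δ₀ (1 / 20)) * (g.len y)⁻¹ *
          (α₁ * (B6.c1 d δ₀ (1 / 20)) * (((cVConc (Fintype.card κ) 1 α₁ a₀ Cq M₂ (∑ i, ‖b i‖) (Real.exp (δ₀ * d₀))) + 0 + 0) * BG * Λ * M + (cVConc (Fintype.card κ) 1 α₁ a₀ Cq M₂ (∑ i, ‖b i‖) (Real.exp (δ₀ * d₀))) * N))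
        ≤ (B₃ * Λ * (B6.c1 d δ₀ (1 / 20)) * (α₁ * (B6.c1 d δ₀ (1 / 20)) * (((cVConc (Fintype.card κ) 1 α₁ a₀ Cq M₂ (∑ i, ‖b i‖) (Real.exp (δ₀ * d₀))) + 0 + 0) * BG * Λ + (cVConc (Fintype.card κ) 1 α₁ a₀ Cq M₂ (∑ i, ‖b i‖) (Real.exp (δ₀ * d₀)))))) * (Bh * g.len y ^ (1 - γ) * cζ * (g.len y)⁻¹ * (N + M)) := by
      have hpre : 0 ≤ B₃ * Bh * g.len y ^ (1 - γ) * cζ * Λ * (B6.c1 d δ₀ (1 / 20)) * (g.len y)⁻¹ :=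
        mul_nonneg (mul_nonneg (mul_nonneg hA₃ hΛ0) hc₂) (inv_nonneg.mpr (hlen y).le)
      refine (mul_le_mul_of_nonneg_left hQq hpre).trans (le_of_eq ?_)
      ring
    have h2 : (B₃ * Λ * (B6.c1 d δ₀ (1 / 20)) * (α₁ * (B6.c1 d δ₀ (1 / 20)) * (((cVConc (Fintype.card κ) 1 α₁ a₀ Cq M₂ (∑ i, ‖b i‖) (Real.exp (δ₀ * d₀))) + 0 + 0) * BG * Λ + (cVConc (Fintype.card κ) 1 α₁ a₀ Cq M₂ (∑ i, ‖b i‖) (Real.exp (δ₀ * d₀)))))) * (Bh * g.len y ^ (1 - γ) * cζ * (g.len y)⁻¹ * (N + M)) ≤ KB₂ * (Bh * g.len y ^ (1 - γ) * cζ * (g.len y)⁻¹ * (N + M)) :=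
      mul_le_mul_of_nonneg_right (by linarith only [hK2, hcoefVI]) hS
    have h3 : N₂ ≤ KB₂ * N₂ := by
      have : 0 ≤ (KB₂ - 1) * N₂ := mul_nonneg (by linarith only [hK2, hcoefVI]) hN₂
      linarith
    have h4 : 0 ≤ KB₁ * (N₂ + Bh * g.len y ^ (1 - γ) * cζ * (g.len y)⁻¹ * (N + M)) := mul_nonneg hKB₁ (add_nonneg hN₂ hS)
    have h5 : N₂ + B₃ * Bh * g.len y ^ (1 - γ) * cζ * Λ * (B6.c1 d δ₀ (1 / 20)) * (g.len y)⁻¹ *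
          (α₁ * (B6.c1 d δ₀ (1 / 20)) * (((cVConc (Fintype.card κ) 1 α₁ a₀ Cq M₂ (∑ i, ‖b i‖) (Real.exp (δ₀ * d₀))) + 0 + 0) * BG * Λ * M + (cVConc (Fintype.card κ) 1 α₁ a₀ Cq M₂ (∑ i, ‖b i‖) (Real.exp (δ₀ * d₀))) * N))
        ≤ (KB₁ + KB₂) * (N₂ + Bh * g.len y ^ (1 - γ) * cζ * (g.len y)⁻¹ * (N + M)) := by nlinarith
    exact mul_le_mul_of_nonneg_right h5 hEx

end Final

end Literature.MathematicalPhysics.QuantumFieldTheory.Balaban1983to89.B9Thm34HolderInputGp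

end
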